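import Mathlib

/-!
# Tier4/Line1/HaarCharInvolution — Haar characters: involutions, conjugates, and the «`χ(φ)² = 1`» trick

Blind re-derivation cell `pub-hodge-repro`, Tier 4 (README §9–§10), seat t4-L1-p5 (prover, LINE L1, gen 2).
Mathlib-only lemmas on `MeasureTheory.addEquivAddHaarChar` (the positive real by which a continuous additive
automorphism `φ` of a locally compact group scales every Haar measure): an involution has character `1`; conjugate
automorphisms have the same character; hence if `ψ ∘ φ = id` and `ψ = J φ J` for an involution `J`, then
`χ(φ)² = χ(φ) χ(ψ) = 1`, so `χ(φ) = 1` and `φ` PRESERVES every regular Haar measure.  This is the modulus input of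
the torus case of the cocompactness wall (rung `hstab` (ii) of the R-c cut, `proofs/t4/L1/I1-c-CENSUS.md` §7):
multiplication by a norm-one element `t` of `k(√−d) ⊗ 𝔸_k` on `𝔸_k²` is conjugate, by the involution `(x, y) ↦ (x, −y)`,
to multiplication by `t̄ = t⁻¹`.  No place decomposition, no generation by elementary matrices.

Nothing here says anything about the status of the Hodge conjecture for CM abelian varieties, which is NOT proved
(HC_CM is NOT proved by anyone in this repository).
-/

set_option autoImplicit false

noncomputable section

namespace Summit.Ventures.HodgeRepro.Tier4.Line1

open MeasureTheory

section HaarChar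

variable {G : Type*} [AddGroup G] [TopologicalSpace G] [IsTopologicalAddGroup G]
  [MeasurableSpace G] [BorelSpace G] [LocallyCompactSpace G]

/-- **An involution has Haar character `1`**: `χ(J)² = χ(J ∘ J) = χ(id) = 1` and `χ(J) > 0`. -/
theorem addEquivAddHaarChar_eq_one_of_involutive (J : G ≃ₜ+ G) (hJ : ∀ x, J (J x) = x) :
    addEquivAddHaarChar J = 1 := by
  have h1 : J.trans J = ContinuousAddEquiv.refl G := ContinuousAddEquiv.ext fun x => hJ x
  have h2 : addEquivAddHaarChar J * addEquivAddHaarChar J = 1 := by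
    rw [← addEquivAddHaarChar_trans, h1, addEquivAddHaarChar_refl]
  have h3 : addEquivAddHaarChar J ^ 2 = 1 := by rw [sq, h2]
  exact (pow_eq_one_iff_of_nonneg (addEquivAddHaarChar_pos J).le two_ne_zero).1 h3

/-- **Conjugate automorphisms have the same Haar character**: if `ψ = J ∘ φ ∘ J` with `J` an involution then
`χ(ψ) = χ(J) χ(φ) χ(J) = χ(φ)`. -/
theorem addEquivAddHaarChar_eq_of_conj (φ ψ J : G ≃ₜ+ G) (hJ : ∀ x, J (J x) = x)
    (hconj : ∀ x, ψ x = J (φ (J x))) : addEquivAddHaarChar ψ = addEquivAddHaarChar φ := by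
  have h1 : ψ = (J.trans φ).trans J := ContinuousAddEquiv.ext fun x => by
    rw [ContinuousAddEquiv.coe_trans, Function.comp_apply, ContinuousAddEquiv.coe_trans,
      Function.comp_apply]
    exact hconj x
  rw [h1, addEquivAddHaarChar_trans, addEquivAddHaarChar_trans,
    addEquivAddHaarChar_eq_one_of_involutive J hJ, one_mul, mul_one]

/-- **The `χ(φ)² = 1` trick**: if `ψ ∘ φ = id` and `ψ` is conjugate to `φ` by an involution `J`, then
`χ(φ)² = χ(φ) χ(ψ) = χ(ψ ∘ φ) = 1`, hence `χ(φ) = 1`. -/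
theorem addEquivAddHaarChar_eq_one_of_conj_inv (φ ψ J : G ≃ₜ+ G) (hJ : ∀ x, J (J x) = x)
    (hconj : ∀ x, ψ x = J (φ (J x))) (hinv : ∀ x, ψ (φ x) = x) : addEquivAddHaarChar φ = 1 := by
  have h1 : φ.trans ψ = ContinuousAddEquiv.refl G := ContinuousAddEquiv.ext fun x => hinv x
  have h2 : addEquivAddHaarChar φ * addEquivAddHaarChar ψ = 1 := by
    rw [← addEquivAddHaarChar_trans, h1, addEquivAddHaarChar_refl]
  rw [addEquivAddHaarChar_eq_of_conj φ ψ J hJ hconj] at h2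
  have h3 : addEquivAddHaarChar φ ^ 2 = 1 := by rw [sq, h2]
  exact (pow_eq_one_iff_of_nonneg (addEquivAddHaarChar_pos φ).le two_ne_zero).1 h3

/-- An automorphism of Haar character `1` preserves the measure of every preimage. -/
theorem measure_preimage_eq_of_addEquivAddHaarChar_eq_one (μ : Measure G) [μ.IsAddHaarMeasure]
    [μ.Regular] (φ : G ≃ₜ+ G) (hφ : addEquivAddHaarChar φ = 1) (X : Set G) :
    μ (φ ⁻¹' X) = μ X := by
  have h := addEquivAddHaarChar_smul_preimage μ (X := X) φ
  rw [hφ, one_smul] at h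
  exact h

/-- An automorphism of Haar character `1` preserves the measure of every image. -/
theorem measure_image_eq_of_addEquivAddHaarChar_eq_one (μ : Measure G) [μ.IsAddHaarMeasure]
    [μ.Regular] (φ : G ≃ₜ+ G) (hφ : addEquivAddHaarChar φ = 1) (X : Set G) :
    μ (φ '' X) = μ X := by
  have hsymm : addEquivAddHaarChar φ.symm = 1 := by
    rw [addEquivAddHaarChar_symm, hφ, inv_one]
  have himg : φ '' X = φ.symm ⁻¹' X := by
    ext y
    constructor
    · rintro ⟨x, hx, rfl⟩
      simpa using hx
    · intro hy
      exact ⟨φ.symm y, hy, by simp⟩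
  rw [himg]
  exact measure_preimage_eq_of_addEquivAddHaarChar_eq_one μ φ.symm hsymm X

end HaarChar

end Summit.Ventures.HodgeRepro.Tier4.Line1

end
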